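import Literature.Geometry.Lorentzian.CarterSliverCapEnergy
import Literature.Geometry.Lorentzian.KerrTortoiseZones
import Literature.Analysis.ODE.QuasiMonotonePersist
import Mathlib.Analysis.Complex.ExponentialBounds
import HarnessLib

/-!
# The horizon-normalised solution crosses the thin cap and the low-coefficient stretch of the
# threshold sliver with bounded loss, then grows outward through the whole barrier
(namespace `Literature.Geometry.Lorentzian.Kerr`.)

Carter's radial equation `u″ + φu = 0`, `φ = ω² − V∘ρ` (DRSR arXiv:1402.7034 §5.2.3), sliver frequency
`σ := ω − mω₊ ≠ 0`, BF-stable sector with margin `(1 + θ₁)(2r₊ω)² ≤ Λ′` (`0 < θ₁ ≤ 1`), forbidden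
interval `{φ ≤ 0} = [b₁, b₂]`, horizon-data solution `u` (`‖u‖ → 1`, `‖u′‖ → |σ|`, flux
`Im(ū u′) = −σ`). Notation: `d = r₊ − r₋`, `S = (r₊² + a²)σ`, `X* = 24S²/(dθ₁²Λ′)`,
`X_low = S²/(8d(|Λ′| + 3))`, `A = C_cap/((r₊² + a²)|σ|)`, `ε = 2|σ|e^{A·X*}`, `N = 131072`,
`C_A = (2r₊)² + a²`, `c = θ₁Λ′/(32C_A)`, `r₁ = r₊ + N·X*`, `r₃ = r₁ + 2ε/c`, `k² = N·X*·d·θ₁Λ′/(16C_A²)`.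

* `sliver_cap_edge` — `X_low ≤ ρ b₁ − r₊ ≤ X*` and `r₊(1 + θ₁/8) ≤ ρ b₂`
  (`coeff_pos_of_sliver`, `coeff_nonpos_of_sliver`, interval structure);
* `sliver_nearBarrier_growth` — under the smallness hypotheses `A·X* ≤ 1`,
  `100ε(log(r₃ − r₊) − log X_low)/κ ≤ 1`, `8ε² ≤ k²`, `r₃ ≤ r₊ + min(d, θ₁r₊/8)` (all of the form
  "`Λ′` large, `|σ|/κ` small", uniformly in `κ`): with `s₃ := ρ⁻¹(r₃) ∈ [b₁, b₂]`,
  (i) `Re(ū u′) ≥ 0` on `[s₃, b₂]`; (ii) `‖u x‖ ≤ 12‖u y‖` for `x ≤ y`, `y ∈ [s₃, b₂]`;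
  (iii) `‖u y‖ ≥ 1/4` on `[s₃, b₂]`; (iv) `‖u x‖ ≤ 3` for `x ≤ b₁`.
  Chain: cap Grönwall (`cap_norm_bounds`: `ζ(b₁) ≤ ε`), `negRate_le_of_start` on `[b₁, s₁]`
  (`s₁ = ρ⁻¹(r₁)`, tortoise length `≤ (25/κ)log(NX*/X_low)`), `negRate_le_of_floor` and
  `negRate_nonpos_of_subsolution` on `[s₁, s₃]` (floor `k²` from `sq_mul_negCoeff_ge_of_sliver'`,
  sub-solution `c(ρ − r₊)`), `re_conj_mul_deriv_nonneg_persist` on `[s₃, b₂]`,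
  `norm_le_exp_mul_norm_of_negRate`.

This is the near-horizon half of the `u`-side input of `OneBarrierKernelBound` in the sliver case of
the near-extremal Kerr programme (crux `KappaExplicitWaveDecay`, BF-stable large-`Λ` kernel bound).

## References
* M. Dafermos, I. Rodnianski, Y. Shlapentokh-Rothman, arXiv:1402.7034 = Ann. of Math. 183 (2016),
  §§5.2.3, 6.2, 8.7 (key `DafermosRodnianskiShlapentokhrothman2014`).
* P. Hartman, *Ordinary Differential Equations* (SIAM Classics 38, 2002), Ch. XI (key `Hartman2002`).
-/

noncomputable section

open Filter Set Literature.Analysis.ODE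
open scoped _root_.Topology _root_.ComplexConjugate

namespace Literature.Geometry.Lorentzian

namespace Kerr

section SliverNear

variable {M a ω Λ : ℝ} {m : ℤ} {ρ : ℝ → ℝ} {u u₁ : ℝ → ℂ}

/-- **The cap edge and the far end of the sliver barrier.** `|a| < M`, `0 < θ₁ ≤ 1`, BF margin,
`Λ′ > 0`, forbidden interval `{φ ≤ 0} = [b₁, b₂]`; if `X* ≤ min(d, θ₁r₊/8)` and
`6r₊|ω|X_low ≤ (r₊² + a²)|σ|` then `X_low ≤ ρ b₁ − r₊ ≤ X*` and `r₊(1 + θ₁/8) ≤ ρ b₂`. [folklore] -/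
theorem sliver_cap_edge (hρ : IsTortoiseRadius M a ρ) (hMa : IsSubextremal M a) {θ₁ : ℝ}
    (hθ₁ : 0 < θ₁) (hθ₁1 : θ₁ ≤ 1) (hBF : (1 + θ₁) * (2 * rPlus M a * ω) ^ 2 ≤ Λ - 2 * a * m * ω)
    (hΛ' : 0 < Λ - 2 * a * m * ω) {b₁ b₂ : ℝ}
    (hF : {x | ω ^ 2 - sepPotential M a ω m Λ (ρ x) ≤ 0} = Icc b₁ b₂) {Xs Xl : ℝ}
    (hXs : Xs = 24 * ((rPlus M a ^ 2 + a ^ 2) * (ω - m * horizonAngularVelocity M a)) ^ 2 /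
      ((rPlus M a - rMinus M a) * θ₁ ^ 2 * (Λ - 2 * a * m * ω)))
    (hXl : Xl = ((rPlus M a ^ 2 + a ^ 2) * (ω - m * horizonAngularVelocity M a)) ^ 2 /
      (8 * (rPlus M a - rMinus M a) * (|Λ - 2 * a * m * ω| + 3)))
    (hXsd : Xs ≤ rPlus M a - rMinus M a) (hXsθ : Xs ≤ θ₁ * rPlus M a / 8)
    (hK : 6 * rPlus M a * |ω| * Xl ≤ (rPlus M a ^ 2 + a ^ 2) * |ω - m * horizonAngularVelocity M a|) :
    Xl ≤ ρ b₁ - rPlus M a ∧ ρ b₁ - rPlus M a ≤ Xs ∧ rPlus M a * (1 + θ₁ / 8) ≤ ρ b₂ := by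
  have ha : |a| < M := hMa
  have hM : 0 < M := hMa.pos
  have hrp : 0 < rPlus M a := rPlus_pos hM a
  have hd : 0 < rPlus M a - rMinus M a := sub_pos.2 hMa.rMinus_lt_rPlus
  set σ := ω - m * horizonAngularVelocity M a with hσdef
  set Λ' := Λ - 2 * a * m * ω with hΛ'def
  have hXs0 : 0 ≤ Xs := by rw [hXs]; positivity
  -- `X_low ≤ X*`
  have hXls : Xl ≤ Xs := by
    rw [hXl, hXs, div_le_div_iff₀ (by positivity) (by positivity)]
    have hS2 : 0 ≤ ((rPlus M a ^ 2 + a ^ 2) * σ) ^ 2 := sq_nonneg _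
    have h1 : (rPlus M a - rMinus M a) * θ₁ ^ 2 * Λ' ≤
        24 * (8 * (rPlus M a - rMinus M a) * (|Λ'| + 3)) := by
      have hθ2 : θ₁ ^ 2 ≤ 1 := by nlinarith
      have hΛa : Λ' ≤ |Λ'| := le_abs_self _
      have : (rPlus M a - rMinus M a) * θ₁ ^ 2 * Λ' ≤ (rPlus M a - rMinus M a) * 1 * |Λ'| :=
        mul_le_mul (mul_le_mul_of_nonneg_left hθ2 hd.le) hΛa hΛ'.le (by positivity)
      nlinarith [abs_nonneg Λ', hd]
    calc ((rPlus M a ^ 2 + a ^ 2) * σ) ^ 2 * ((rPlus M a - rMinus M a) * θ₁ ^ 2 * Λ')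
        ≤ ((rPlus M a ^ 2 + a ^ 2) * σ) ^ 2 * (24 * (8 * (rPlus M a - rMinus M a) * (|Λ'| + 3))) :=
          mul_le_mul_of_nonneg_left h1 hS2
      _ = 24 * ((rPlus M a ^ 2 + a ^ 2) * σ) ^ 2 * (8 * (rPlus M a - rMinus M a) * (|Λ'| + 3)) := by ring
  -- membership in the forbidden interval
  have hmem : ∀ x, ω ^ 2 - sepPotential M a ω m Λ (ρ x) ≤ 0 ↔ x ∈ Icc b₁ b₂ := fun x ↦ by
    rw [← hF]; rfl
  -- the point at radius `r₊(1 + θ₁/8)` is in the barrier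
  obtain ⟨tθ, htθ⟩ := hρ.exists_apply_eq (r := rPlus M a * (1 + θ₁ / 8)) (by nlinarith)
  have hθmem : tθ ∈ Icc b₁ b₂ := by
    rw [← hmem]
    refine coeff_nonpos_of_sliver ha hθ₁ hθ₁1 hBF hΛ' (hρ.rPlus_lt tθ) htθ.le ?_
    rw [← hXs, htθ]; linarith
  refine ⟨?_, ?_, ?_⟩
  · -- `ρ b₁ − r₊ ≥ X_low`: otherwise `φ b₁ > 0`, but `b₁ ∈ [b₁, b₂]`
    by_contra hcon
    push Not at hcon
    have hb₁mem : b₁ ∈ Icc b₁ b₂ := left_mem_Icc.2 (hθmem.1.trans hθmem.2)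
    have hle := (hmem b₁).2 hb₁mem
    have hXl0 : 0 ≤ Xl := by rw [hXl]; positivity
    have hpos := coeff_pos_of_sliver (ω := ω) (Λ := Λ) (m := m) ha (hρ.rPlus_lt b₁)
      (by linarith [hXls, hXsd]) ?_ (by rw [← hXl]; exact hcon)
    · linarith
    · calc 6 * rPlus M a * |ω| * (ρ b₁ - rPlus M a) ≤ 6 * rPlus M a * |ω| * Xl :=
            mul_le_mul_of_nonneg_left hcon.le (by positivity)
        _ ≤ (rPlus M a ^ 2 + a ^ 2) * |σ| := hK
  · -- `ρ b₁ − r₊ ≤ X*`: the point at radius `r₊ + X*` (if `X* > 0`) is in the barrier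
    rcases hXs0.eq_or_lt with h0 | h0
    · -- `X* = 0` forces `σ = 0`… then `X_low = 0` too; but in any case `b₁ ≤ tθ` bounds suffice?
      -- simpler: `X* = 0` gives `φ ≤ 0` at every radius in `(r₊, r₊(1+θ₁/8)]`, so `b₁ ≤ x` for all
      -- `x` with `ρ x` small, forcing `ρ b₁ = r₊`-limit: use the points `ρ⁻¹(r₊ + δ)`.
      by_contra hcon
      push Not at hcon
      rw [← h0] at hcon
      obtain ⟨t, ht⟩ := hρ.exists_apply_eq (r := (rPlus M a + ρ b₁) / 2)
        (by linarith [hρ.rPlus_lt b₁])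
      have htmem : t ∈ Icc b₁ b₂ := by
        rw [← hmem]
        refine coeff_nonpos_of_sliver ha hθ₁ hθ₁1 hBF hΛ' (hρ.rPlus_lt t) ?_ ?_
        · rw [ht]; have := htθ ▸ (hρ.strictMono hMa).monotone (hθmem.1); nlinarith [this]
        · rw [← hXs, ← h0, ht]; linarith [hρ.rPlus_lt b₁]
      have := (hρ.strictMono hMa).monotone htmem.1
      rw [ht] at this; linarith [hρ.rPlus_lt b₁]
    · obtain ⟨t, ht⟩ := hρ.exists_apply_eq (r := rPlus M a + Xs) (by linarith)
      have htmem : t ∈ Icc b₁ b₂ := by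
        rw [← hmem]
        refine coeff_nonpos_of_sliver ha hθ₁ hθ₁1 hBF hΛ' (hρ.rPlus_lt t) ?_ ?_
        · rw [ht]; linarith
        · rw [← hXs, ht]; linarith
      have := (hρ.strictMono hMa).monotone htmem.1
      rw [ht] at this; linarith
  · have := (hρ.strictMono hMa).monotone hθmem.2
    rwa [htθ] at this

/-- Numerical facts: `e^{1/2} ≤ 17/10`, `2e^{3/2} ≤ 10`, `1/4 ≤ e^{−1}/√2`, `√2·e^{1/2} ≤ 3`. [folklore] -/
theorem sliver_exp_facts : Real.exp (1 / 2) ≤ 17 / 10 ∧ 2 * Real.exp (3 / 2) ≤ 10 ∧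
    1 / 4 ≤ Real.exp (-1) / Real.sqrt 2 ∧ Real.sqrt 2 * Real.exp (1 / 2) ≤ 3 := by
  have he1 : Real.exp 1 < 2.7182818286 := Real.exp_one_lt_d9
  have he0 : 0 < Real.exp (1 / 2) := Real.exp_pos _
  have hsq : Real.exp (1 / 2) ^ 2 = Real.exp 1 := by rw [← Real.exp_nat_mul]; norm_num
  have hhalf : Real.exp (1 / 2) ≤ 17 / 10 := by nlinarith
  have hsq2 := Real.sq_sqrt (show (0:ℝ) ≤ 2 by norm_num)
  have hs0 : 0 < Real.sqrt 2 := by positivity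
  have hs2 : Real.sqrt 2 ≤ 1.415 := by nlinarith
  refine ⟨hhalf, ?_, ?_, ?_⟩
  · have : Real.exp (3 / 2) = Real.exp 1 * Real.exp (1 / 2) := by rw [← Real.exp_add]; norm_num
    rw [this]; nlinarith [Real.exp_pos 1]
  · rw [le_div_iff₀ hs0, Real.exp_neg, inv_eq_one_div, le_div_iff₀ (Real.exp_pos 1)]
    nlinarith [Real.exp_pos 1]
  · nlinarith

/-- **Quasi-monotone growth of the horizon-normalised solution through the sliver barrier.**
See the module docstring for the notation and the chain of lemmas. Hypotheses: tortoise radius,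
`|a| < M`, `0 < θ₁ ≤ 1`, BF margin, `Λ′ > 0`, `σ ≠ 0`, forbidden interval `[b₁, b₂]`, horizon data and
flux of `u`, the abbreviations as equations, and the four smallness conditions. Conclusions at the
point `s₃` with `ρ s₃ = r₃`: `b₁ ≤ s₃ ≤ b₂`, `Re(ū u′) ≥ 0` on `[s₃, b₂]`, `‖u x‖ ≤ 12‖u y‖` for
`x ≤ y ∈ [s₃, b₂]`, `1/4 ≤ ‖u y‖` on `[s₃, b₂]`, `‖u x‖ ≤ 3` for `x ≤ b₁`.
[cite: DafermosRodnianskiShlapentokhrothman2014, §8.7] -/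
theorem sliver_nearBarrier_growth (hρ : IsTortoiseRadius M a ρ) (hMa : IsSubextremal M a) {θ₁ : ℝ}
    (hθ₁ : 0 < θ₁) (hθ₁1 : θ₁ ≤ 1) (hBF : (1 + θ₁) * (2 * rPlus M a * ω) ^ 2 ≤ Λ - 2 * a * m * ω)
    (hΛ' : 0 < Λ - 2 * a * m * ω) (hσ : ω - m * horizonAngularVelocity M a ≠ 0) {b₁ b₂ : ℝ}
    (hF : {x | ω ^ 2 - sepPotential M a ω m Λ (ρ x) ≤ 0} = Icc b₁ b₂)
    (hu : ∀ x, HasDerivAt u (u₁ x) x ∧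
      HasDerivAt u₁ (-(((ω ^ 2 - sepPotential M a ω m Λ (ρ x) : ℝ) : ℂ) * u x)) x)
    (hlim : Tendsto (fun x ↦ ‖u x‖) atBot (𝓝 1))
    (hlim₁ : Tendsto (fun x ↦ ‖u₁ x‖) atBot (𝓝 |ω - m * horizonAngularVelocity M a|))
    (hflux : ∀ x, (starRingEnd ℂ (u x) * u₁ x).im = -(ω - m * horizonAngularVelocity M a))
    {Ccap A Xs Xl ε CA c r₃ s₃ : ℝ}
    (hC : Ccap = (3 * rPlus M a * |ω| * (4 * M * rPlus M a * |ω - m * horizonAngularVelocity M a| +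
          3 * rPlus M a * |ω| * (rPlus M a - rMinus M a)) +
          21 * (ω - m * horizonAngularVelocity M a) ^ 2 * rPlus M a ^ 3) / (rPlus M a - rMinus M a) +
        |Λ - 2 * a * m * ω| + 3)
    (hA : A = Ccap / ((rPlus M a ^ 2 + a ^ 2) * |ω - m * horizonAngularVelocity M a|))
    (hXs : Xs = 24 * ((rPlus M a ^ 2 + a ^ 2) * (ω - m * horizonAngularVelocity M a)) ^ 2 /
      ((rPlus M a - rMinus M a) * θ₁ ^ 2 * (Λ - 2 * a * m * ω)))
    (hXl : Xl = ((rPlus M a ^ 2 + a ^ 2) * (ω - m * horizonAngularVelocity M a)) ^ 2 /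
      (8 * (rPlus M a - rMinus M a) * (|Λ - 2 * a * m * ω| + 3)))
    (hε : ε = 2 * |ω - m * horizonAngularVelocity M a| * Real.exp (A * Xs))
    (hCA : CA = (2 * rPlus M a) ^ 2 + a ^ 2) (hc : c = θ₁ * (Λ - 2 * a * m * ω) / (32 * CA))
    (hr₃ : r₃ = rPlus M a + 131072 * Xs + 2 * ε / c) (hs₃ : ρ s₃ = r₃)
    -- smallness conditions
    (hK : 6 * rPlus M a * |ω| * Xl ≤ (rPlus M a ^ 2 + a ^ 2) * |ω - m * horizonAngularVelocity M a|)
    (h1 : A * Xs ≤ 1)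
    (h2 : 100 * ε * (Real.log (r₃ - rPlus M a) - Real.log Xl) / surfaceGravity M a ≤ 1)
    (h3 : 8 * ε ^ 2 ≤ 131072 * Xs * (rPlus M a - rMinus M a) * (θ₁ * (Λ - 2 * a * m * ω)) / (16 * CA ^ 2))
    (h4 : r₃ ≤ rPlus M a + min (rPlus M a - rMinus M a) (θ₁ * rPlus M a / 8)) :
    b₁ ≤ s₃ ∧ s₃ ≤ b₂ ∧
    (∀ x ∈ Icc s₃ b₂, 0 ≤ (starRingEnd ℂ (u x) * u₁ x).re) ∧
    (∀ x y, x ≤ y → s₃ ≤ y → y ≤ b₂ → ‖u x‖ ≤ 12 * ‖u y‖) ∧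
    (∀ y ∈ Icc s₃ b₂, 1 / 4 ≤ ‖u y‖) ∧
    (∀ x, x ≤ b₁ → ‖u x‖ ≤ 3) := by
  have ha : |a| < M := hMa
  have hM : 0 < M := hMa.pos
  have hrp : 0 < rPlus M a := rPlus_pos hM a
  have hd : 0 < rPlus M a - rMinus M a := sub_pos.2 hMa.rMinus_lt_rPlus
  have hrm0 : 0 ≤ rMinus M a := rMinus_nonneg_of_abs_le ha.le
  have hκ : 0 < surfaceGravity M a := hMa.surfaceGravity_pos
  have hr2M : rPlus M a ≤ 2 * M := rPlus_le_two_mul_self hM.le a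
  have hσa : 0 < |ω - m * horizonAngularVelocity M a| := abs_pos.2 hσ
  have hAp : 0 < rPlus M a ^ 2 + a ^ 2 := by positivity
  have hS2 : 0 < ((rPlus M a ^ 2 + a ^ 2) * (ω - m * horizonAngularVelocity M a)) ^ 2 := by positivity
  have hXs0 : 0 < Xs := by rw [hXs]; positivity
  have hXl0 : 0 < Xl := by rw [hXl]; positivity
  have hC0 : 0 ≤ Ccap := by rw [hC]; positivity
  have hA0 : 0 ≤ A := by rw [hA]; positivity
  have hε0 : 0 < ε := by rw [hε]; positivity
  have hCA0 : 0 < CA := by rw [hCA]; positivity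
  have hc0 : 0 < c := by rw [hc]; positivity
  have hεc : 0 < 2 * ε / c := by positivity
  -- radii
  have hmin1 := min_le_left (rPlus M a - rMinus M a) (θ₁ * rPlus M a / 8)
  have hmin2 := min_le_right (rPlus M a - rMinus M a) (θ₁ * rPlus M a / 8)
  have h4d : r₃ ≤ rPlus M a + (rPlus M a - rMinus M a) := by linarith only [h4, hmin1]
  have h4θ : r₃ ≤ rPlus M a * (1 + θ₁ / 8) := by linarith only [h4, hmin2]
  have hr13 : rPlus M a + 131072 * Xs < r₃ := by rw [hr₃]; linarith only [hεc]
  have hXsd : Xs ≤ rPlus M a - rMinus M a := by linarith only [hr13, h4d, hXs0]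
  have hXsθ : Xs ≤ θ₁ * rPlus M a / 8 := by linarith only [hr13, h4θ, hXs0]
  have hr32 : r₃ ≤ 2 * rPlus M a := by linarith only [h4d, hrm0]
  obtain ⟨hb1l, hb1u, hb2⟩ := sliver_cap_edge hρ hMa hθ₁ hθ₁1 hBF hΛ' hF hXs hXl hXsd hXsθ hK
  -- the point `s₁`
  obtain ⟨s₁, hs₁⟩ := hρ.exists_apply_eq (r := rPlus M a + 131072 * Xs) (by linarith)
  have hmono := (hρ.strictMono hMa).monotone
  have hle := fun x y ↦ (hρ.le_iff_le hMa (x := x) (y := y))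
  have hb₁s₁ : b₁ ≤ s₁ := (hle b₁ s₁).1 (by rw [hs₁]; linarith)
  have hs₁s₃ : s₁ ≤ s₃ := (hle s₁ s₃).1 (by rw [hs₁, hs₃]; exact hr13.le)
  have hs₃b₂ : s₃ ≤ b₂ := (hle s₃ b₂).1 (by rw [hs₃]; linarith)
  have hb₁s₃ : b₁ ≤ s₃ := hb₁s₁.trans hs₁s₃
  -- the forbidden interval
  have hmem : ∀ x, ω ^ 2 - sepPotential M a ω m Λ (ρ x) ≤ 0 ↔ x ∈ Icc b₁ b₂ := fun x ↦ by
    rw [← hF]; rfl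
  -- the equation in `q`-form, non-vanishing, `q ≥ 0` on the interval
  have hu' : ∀ x, HasDerivAt u (u₁ x) x ∧
      HasDerivAt u₁ (((sepPotential M a ω m Λ (ρ x) - ω ^ 2 : ℝ) : ℂ) * u x) x := by
    intro x
    refine ⟨(hu x).1, ?_⟩
    have h := (hu x).2
    have e : -(((ω ^ 2 - sepPotential M a ω m Λ (ρ x) : ℝ) : ℂ) * u x) =
        ((sepPotential M a ω m Λ (ρ x) - ω ^ 2 : ℝ) : ℂ) * u x := by push_cast; ring
    rwa [e] at h
  have hne : ∀ x, u x ≠ 0 := by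
    intro x h0
    have := hflux x
    rw [h0, map_zero, zero_mul, Complex.zero_im] at this
    exact hσ (by linarith)
  have hq0 : ∀ x ∈ Icc b₁ b₂, 0 ≤ sepPotential M a ω m Λ (ρ x) - ω ^ 2 := by
    intro x hx; have := (hmem x).2 hx; linarith
  -- the cap bounds at points `x ≤ b₁`
  have hcapx : ∀ x, x ≤ b₁ → ρ x ≤ rPlus M a + (rPlus M a - rMinus M a) ∧
      A * (ρ x - rPlus M a) ≤ 1 := by
    intro x hx
    have h1' : ρ x ≤ ρ b₁ := hmono hx
    refine ⟨by linarith, ?_⟩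
    calc A * (ρ x - rPlus M a) ≤ A * Xs := mul_le_mul_of_nonneg_left (by linarith) hA0
      _ ≤ 1 := h1
  obtain ⟨hexp1, hexp2, hexp3, hexp4⟩ := sliver_exp_facts
  -- (O4): `‖u x‖ ≤ 3` for `x ≤ b₁`
  have hO4 : ∀ x, x ≤ b₁ → ‖u x‖ ≤ 3 := by
    intro x hx
    obtain ⟨hxd, hxA⟩ := hcapx x hx
    have hcb := (cap_norm_bounds hρ hMa hσ hu hlim hlim₁ hflux hC hxd).1
    rw [← hA] at hcb
    calc ‖u x‖ ≤ Real.sqrt 2 * Real.exp (A * (ρ x - rPlus M a) / 2) := hcb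
      _ ≤ Real.sqrt 2 * Real.exp (1 / 2) := by gcongr
      _ ≤ 3 := hexp4
  -- `‖u b₁‖² ≥ e^{-1}/2`
  have hub₁ : Real.exp (-1) / 2 ≤ ‖u b₁‖ ^ 2 := by
    obtain ⟨hxd, hxA⟩ := hcapx b₁ le_rfl
    have hcb := (cap_norm_bounds hρ hMa hσ hu hlim hlim₁ hflux hC hxd).2.1
    rw [← hA] at hcb
    refine le_trans ?_ hcb
    gcongr
  -- Step A: `ζ(b₁) ≤ ε`
  have hstart : -(starRingEnd ℂ (u b₁) * u₁ b₁).re / ‖u b₁‖ ^ 2 ≤ ε := by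
    obtain ⟨hxd, hxA⟩ := hcapx b₁ le_rfl
    have hcb := (cap_norm_bounds hρ hMa hσ hu hlim hlim₁ hflux hC hxd).2.2
    rw [← hA] at hcb
    have hpos : 0 < ‖u b₁‖ ^ 2 := by have := hne b₁; positivity
    rw [div_le_iff₀ hpos]
    have hexp : Real.exp (A * (ρ b₁ - rPlus M a)) ≤ Real.exp (A * Xs) :=
      Real.exp_le_exp.2 (mul_le_mul_of_nonneg_left hb1u hA0)
    have : 2 * |ω - m * horizonAngularVelocity M a| * Real.exp (A * (ρ b₁ - rPlus M a)) * ‖u b₁‖ ^ 2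
        ≤ ε * ‖u b₁‖ ^ 2 := by
      rw [hε]; gcongr
    linarith
  -- tortoise lengths: `s₃ − b₁ ≤ (25/κ)(log(r₃ − r₊) − log X_low)`
  have hlen3 : s₃ - b₁ ≤ 25 / surfaceGravity M a * (Real.log (r₃ - rPlus M a) - Real.log Xl) := by
    have h := hρ.sub_le_mul_log_div hMa hb₁s₃ (by rw [hs₃]; linarith)
    rw [hs₃] at h
    refine h.trans (mul_le_mul_of_nonneg_left ?_ (by positivity))
    have : Real.log Xl ≤ Real.log (ρ b₁ - rPlus M a) := Real.log_le_log hXl0 hb1l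
    linarith
  have hlen1 : s₁ - b₁ ≤ 25 / surfaceGravity M a * (Real.log (r₃ - rPlus M a) - Real.log Xl) := by
    have : s₁ - b₁ ≤ s₃ - b₁ := by linarith
    exact this.trans hlen3
  have hL : 4 * ε * (25 / surfaceGravity M a * (Real.log (r₃ - rPlus M a) - Real.log Xl)) ≤ 1 := by
    have e : 4 * ε * (25 / surfaceGravity M a * (Real.log (r₃ - rPlus M a) - Real.log Xl)) =
        100 * ε * (Real.log (r₃ - rPlus M a) - Real.log Xl) / surfaceGravity M a := by
      field_simp; ring
    rw [e]; exact h2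
  -- Step A: `ζ ≤ 2ε` on `[b₁, s₁]`
  have huI : ∀ x ∈ Icc b₁ b₂, HasDerivAt u (u₁ x) x ∧
      HasDerivAt u₁ (((sepPotential M a ω m Λ (ρ x) - ω ^ 2 : ℝ) : ℂ) * u x) x := fun x _ ↦ hu' x
  have hζ1 := negRate_le_of_start huI (fun x _ ↦ hne x) hq0 hε0 ⟨hb₁s₁, hs₁s₃.trans hs₃b₂⟩
    ((mul_le_mul_of_nonneg_left hlen1 (by positivity)).trans hL) hstart
  -- Step B: the floor `k²` on `[s₁, s₃]`
  set k2 := 131072 * Xs * (rPlus M a - rMinus M a) * (θ₁ * (Λ - 2 * a * m * ω)) / (16 * CA ^ 2) with hk2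
  have hk20 : 0 < k2 := by rw [hk2]; positivity
  have hfloor : ∀ x ∈ Icc s₁ s₃, k2 ≤ sepPotential M a ω m Λ (ρ x) - ω ^ 2 ∧
      2 * (delta M a (ρ x) * (θ₁ * (Λ - 2 * a * m * ω) / 32) / (ρ x ^ 2 + a ^ 2) ^ 2) ≤
        sepPotential M a ω m Λ (ρ x) - ω ^ 2 ∧ ρ x ^ 2 + a ^ 2 ≤ CA := by
    intro x hx
    have hx1 : rPlus M a + 131072 * Xs ≤ ρ x := by rw [← hs₁]; exact hmono hx.1
    have hx3 : ρ x ≤ r₃ := by rw [← hs₃]; exact hmono hx.2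
    have hrx : rPlus M a < ρ x := hρ.rPlus_lt x
    have hAx : 0 < (ρ x ^ 2 + a ^ 2) ^ 2 := by have := hρ.sq_add_sq_pos hMa x; positivity
    have hsl := sq_mul_negCoeff_ge_of_sliver' (ω := ω) (Λ := Λ) (m := m) ha hθ₁ hθ₁1 hBF hΛ' hrx
      (hx3.trans h4θ) (by
        have e : 48 * ((rPlus M a ^ 2 + a ^ 2) * (ω - m * horizonAngularVelocity M a)) ^ 2 /
            ((rPlus M a - rMinus M a) * θ₁ ^ 2 * (Λ - 2 * a * m * ω)) = 2 * Xs := by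
          rw [hXs]; ring
        rw [e]; linarith)
    have hCAx : ρ x ^ 2 + a ^ 2 ≤ CA := by
      have t : ρ x ≤ 2 * rPlus M a := hx3.trans hr32
      rw [hCA]; nlinarith only [t, hρ.pos hMa x]
    have hΔx : 131072 * Xs * (rPlus M a - rMinus M a) ≤ delta M a (ρ x) := by
      rw [delta_eq_mul ha.le]
      exact mul_le_mul (by linarith only [hx1]) (by linarith only [hx1, hXs0, hrm0]) hd.le
        (by linarith only [hx1, hXs0])
    have hΔ0 : 0 ≤ delta M a (ρ x) := delta_nonneg ha.le hrx.le
    have hθΛ : 0 < θ₁ * (Λ - 2 * a * m * ω) := mul_pos hθ₁ hΛ'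
    have h2' : delta M a (ρ x) * (θ₁ * (Λ - 2 * a * m * ω) / 16) / (ρ x ^ 2 + a ^ 2) ^ 2 ≤
        sepPotential M a ω m Λ (ρ x) - ω ^ 2 := by
      rw [div_le_iff₀ hAx]; linarith only [hsl]
    refine ⟨?_, ?_, hCAx⟩
    · -- `k2 ≤ Δθ₁Λ′/(16 (ρ²+a²)²) ≤ q`
      refine le_trans ?_ h2'
      rw [hk2, div_le_div_iff₀ (by positivity) hAx]
      have hCA2 : (ρ x ^ 2 + a ^ 2) ^ 2 ≤ CA ^ 2 :=
        pow_le_pow_left₀ (hρ.sq_add_sq_pos hMa x).le hCAx 2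
      have t1 : 131072 * Xs * (rPlus M a - rMinus M a) * (θ₁ * (Λ - 2 * a * m * ω)) ≤
          delta M a (ρ x) * (θ₁ * (Λ - 2 * a * m * ω)) :=
        mul_le_mul_of_nonneg_right hΔx hθΛ.le
      have hΔθ : 0 ≤ delta M a (ρ x) * (θ₁ * (Λ - 2 * a * m * ω)) := mul_nonneg hΔ0 hθΛ.le
      calc 131072 * Xs * (rPlus M a - rMinus M a) * (θ₁ * (Λ - 2 * a * m * ω)) * (ρ x ^ 2 + a ^ 2) ^ 2
          ≤ delta M a (ρ x) * (θ₁ * (Λ - 2 * a * m * ω)) * (ρ x ^ 2 + a ^ 2) ^ 2 :=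
            mul_le_mul_of_nonneg_right t1 hAx.le
        _ ≤ delta M a (ρ x) * (θ₁ * (Λ - 2 * a * m * ω)) * CA ^ 2 :=
            mul_le_mul_of_nonneg_left hCA2 hΔθ
        _ = delta M a (ρ x) * (θ₁ * (Λ - 2 * a * m * ω) / 16) * (16 * CA ^ 2) := by ring
    · have e : 2 * (delta M a (ρ x) * (θ₁ * (Λ - 2 * a * m * ω) / 32) / (ρ x ^ 2 + a ^ 2) ^ 2) =
          delta M a (ρ x) * (θ₁ * (Λ - 2 * a * m * ω) / 16) / (ρ x ^ 2 + a ^ 2) ^ 2 := by ring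
      rw [e]; exact h2'
  -- Step B: `ζ ≤ 2ε` on `[s₁, s₃]`
  set k := Real.sqrt k2 with hk
  have hk0 : 0 < k := Real.sqrt_pos.2 hk20
  have hkk : k ^ 2 = k2 := Real.sq_sqrt hk20.le
  have h8 : 8 * ε ^ 2 ≤ k2 := by rw [hk2]; exact h3
  have hεk : 2 * ε < k := by
    have : (2 * ε) ^ 2 < k ^ 2 := by rw [hkk]; nlinarith only [h8, hε0]
    exact (pow_lt_pow_iff_left₀ (by positivity) hk0.le two_ne_zero).1 this
  have hu3 : ∀ x ∈ Icc b₁ s₃, HasDerivAt u (u₁ x) x ∧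
      HasDerivAt u₁ (((sepPotential M a ω m Λ (ρ x) - ω ^ 2 : ℝ) : ℂ) * u x) x := fun x _ ↦ hu' x
  have hqk : ∀ x ∈ Icc s₁ s₃, k ^ 2 ≤ sepPotential M a ω m Λ (ρ x) - ω ^ 2 := fun x hx ↦ by
    rw [hkk]; exact (hfloor x hx).1
  have hζ2 := negRate_le_of_floor hu3 (fun x _ ↦ hne x) hε0 ⟨hb₁s₁, hs₁s₃⟩ hεk hqk
    (hζ1 s₁ (right_mem_Icc.2 hb₁s₁))
  -- Step C: the sub-solution `Q = c(ρ − r₊)` on `[s₁, s₃]`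
  have hQ : ∀ x ∈ Icc s₁ s₃, HasDerivAt (fun t ↦ c * (ρ t - rPlus M a))
      (c * (delta M a (ρ x) / (ρ x ^ 2 + a ^ 2))) x :=
    fun x _ ↦ ((hρ.hasDerivAt x).sub_const _).const_mul c
  have hQ' : ∀ x ∈ Icc s₁ s₃, c * (delta M a (ρ x) / (ρ x ^ 2 + a ^ 2)) ≤
      (sepPotential M a ω m Λ (ρ x) - ω ^ 2) - 4 * ε ^ 2 := by
    intro x hx
    obtain ⟨hq1, hq2, hCAx⟩ := hfloor x hx
    have hAx0 : 0 < ρ x ^ 2 + a ^ 2 := hρ.sq_add_sq_pos hMa x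
    have hΔ0 : 0 ≤ delta M a (ρ x) := delta_nonneg ha.le (hρ.rPlus_lt x).le
    -- `Q′ ≤ P := Δθ₁Λ′/(32(ρ²+a²)²)` since `CA ≥ ρ² + a²`
    have hP : c * (delta M a (ρ x) / (ρ x ^ 2 + a ^ 2)) ≤
        delta M a (ρ x) * (θ₁ * (Λ - 2 * a * m * ω) / 32) / (ρ x ^ 2 + a ^ 2) ^ 2 := by
      rw [hc, div_mul_div_comm, mul_div_assoc', div_le_div_iff₀ (by positivity) (by positivity)]
      have hθΛ : 0 ≤ θ₁ * (Λ - 2 * a * m * ω) := (mul_pos hθ₁ hΛ').le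
      have : θ₁ * (Λ - 2 * a * m * ω) * delta M a (ρ x) * (ρ x ^ 2 + a ^ 2) ^ 2 ≤
          θ₁ * (Λ - 2 * a * m * ω) * delta M a (ρ x) * ((ρ x ^ 2 + a ^ 2) * CA) := by
        refine mul_le_mul_of_nonneg_left ?_ (mul_nonneg hθΛ hΔ0)
        rw [sq]; exact mul_le_mul_of_nonneg_left hCAx hAx0.le
      calc θ₁ * (Λ - 2 * a * m * ω) * delta M a (ρ x) * (ρ x ^ 2 + a ^ 2) ^ 2
          ≤ θ₁ * (Λ - 2 * a * m * ω) * delta M a (ρ x) * ((ρ x ^ 2 + a ^ 2) * CA) := this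
        _ = delta M a (ρ x) * (θ₁ * (Λ - 2 * a * m * ω)) / 32 * (32 * CA * (ρ x ^ 2 + a ^ 2)) := by
            ring
    -- `4ε² ≤ k²/2 ≤ q/2`
    have h4ε : 4 * ε ^ 2 ≤ (sepPotential M a ω m Λ (ρ x) - ω ^ 2) / 2 := by linarith only [h8, hq1]
    linarith only [hP, h4ε, hq2]
  have hgain : 2 * ε ≤ c * (ρ s₃ - rPlus M a) - c * (ρ s₁ - rPlus M a) := by
    rw [hs₃, hs₁, hr₃]
    have : c * (rPlus M a + 131072 * Xs + 2 * ε / c - rPlus M a) -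
        c * (rPlus M a + 131072 * Xs - rPlus M a) = 2 * ε := by field_simp; ring
    rw [this]
  have hpos₃ := negRate_nonpos_of_subsolution hu3 (fun x _ ↦ hne x) hb₁s₁ hs₁s₃ le_rfl hk0 hqk hζ2
    hQ hQ' hgain
  have h0₃ : 0 ≤ (starRingEnd ℂ (u s₃) * u₁ s₃).re := hpos₃ s₃ (left_mem_Icc.2 le_rfl)
  -- Step D: persistence on `[s₃, b₂]`
  have huD : ∀ x ∈ Icc s₃ b₂, HasDerivAt u (u₁ x) x ∧
      HasDerivAt u₁ (((sepPotential M a ω m Λ (ρ x) - ω ^ 2 : ℝ) : ℂ) * u x) x := fun x _ ↦ hu' x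
  have hO1 : ∀ x ∈ Icc s₃ b₂, 0 ≤ (starRingEnd ℂ (u x) * u₁ x).re :=
    re_conj_mul_deriv_nonneg_persist huD (fun x _ ↦ hne x)
      (fun x hx ↦ hq0 x ⟨hb₁s₃.trans hx.1, hx.2⟩) h0₃
  -- Step E: quasi-monotonicity on `[b₁, b₂]`
  have hζall : ∀ x ∈ Icc b₁ b₂, -(2 * ε) * ‖u x‖ ^ 2 ≤ (starRingEnd ℂ (u x) * u₁ x).re := by
    intro x hx
    have hpos : 0 < ‖u x‖ ^ 2 := by have := hne x; positivity
    rcases le_total x s₃ with hxs | hxs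
    · have hζx : -(starRingEnd ℂ (u x) * u₁ x).re / ‖u x‖ ^ 2 ≤ 2 * ε := by
        rcases le_total x s₁ with hx1 | hx1
        · exact hζ1 x ⟨hx.1, hx1⟩
        · exact hζ2 x ⟨hx1, hxs⟩
      have := (div_le_iff₀ hpos).1 hζx
      linarith only [this]
    · have h1 := hO1 x ⟨hxs, hx.2⟩
      have h2 : 0 ≤ 2 * ε * ‖u x‖ ^ 2 := by positivity
      linarith only [h1, h2]
  have hE := fun x y (hbx : b₁ ≤ x) (hxy : x ≤ y) (hyT : y ≤ b₂) (hs₃y : s₃ ≤ y) ↦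
    norm_le_exp_mul_norm_of_negRate huI hε0.le hb₁s₃ hζall hO1 hbx hxy hyT hs₃y
  have hexpE : Real.exp (2 * ε * (s₃ - b₁)) ≤ Real.exp (1 / 2) := by
    rw [Real.exp_le_exp]
    have := mul_le_mul_of_nonneg_left hlen3 (show 0 ≤ 2 * ε by positivity)
    linarith [hL]
  -- (O3): `‖u y‖ ≥ 1/4` on `[s₃, b₂]`
  have hO3 : ∀ y ∈ Icc s₃ b₂, 1 / 4 ≤ ‖u y‖ := by
    intro y hy
    have h1 := hE b₁ y le_rfl (hb₁s₃.trans hy.1) hy.2 hy.1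
    have h2 : ‖u b₁‖ ≤ Real.exp (1 / 2) * ‖u y‖ :=
      h1.trans (mul_le_mul_of_nonneg_right hexpE (norm_nonneg _))
    -- `‖u b₁‖ ≥ e^{-1/2}/√2`
    have h3 : Real.exp (-1) / 2 ≤ (Real.exp (1 / 2) * ‖u y‖) ^ 2 :=
      hub₁.trans (pow_le_pow_left₀ (norm_nonneg _) h2 2)
    have h4' : (Real.exp (1 / 2) * ‖u y‖) ^ 2 = Real.exp 1 * ‖u y‖ ^ 2 := by
      rw [mul_pow, ← Real.exp_nat_mul]; norm_num
    rw [h4'] at h3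
    -- `e^{-1}/2 ≤ e ‖u y‖²` gives `‖u y‖² ≥ e^{-2}/2 ≥ 1/16`
    have he1 : Real.exp 1 < 2.7182818286 := Real.exp_one_lt_d9
    have he2 : Real.exp (-1) * Real.exp 1 = 1 := by rw [← Real.exp_add]; norm_num
    have hp0 : 0 < Real.exp (-1) := Real.exp_pos _
    have hp : 0.367 ≤ Real.exp (-1) := by
      have : 1 ≤ Real.exp (-1) * 2.7182818286 := by
        calc (1:ℝ) = Real.exp (-1) * Real.exp 1 := he2.symm
          _ ≤ Real.exp (-1) * 2.7182818286 := mul_le_mul_of_nonneg_left he1.le hp0.le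
      linarith only [this]
    have h5' : Real.exp (-1) / 2 * Real.exp (-1) ≤ ‖u y‖ ^ 2 := by
      have := mul_le_mul_of_nonneg_right h3 hp0.le
      have e : Real.exp 1 * ‖u y‖ ^ 2 * Real.exp (-1) = ‖u y‖ ^ 2 := by
        have : Real.exp 1 * ‖u y‖ ^ 2 * Real.exp (-1) = (Real.exp (-1) * Real.exp 1) * ‖u y‖ ^ 2 := by
          ring
        rw [this, he2, one_mul]
      linarith only [this, e]
    have h5 : (1 / 4) ^ 2 ≤ ‖u y‖ ^ 2 := by
      have hp2 : (0.367:ℝ) ^ 2 ≤ Real.exp (-1) ^ 2 := pow_le_pow_left₀ (by norm_num) hp 2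
      have e : Real.exp (-1) / 2 * Real.exp (-1) = Real.exp (-1) ^ 2 / 2 := by ring
      rw [e] at h5'
      linarith only [h5', hp2]
    exact (pow_le_pow_iff_left₀ (by norm_num) (norm_nonneg _) two_ne_zero).1 h5
  refine ⟨hb₁s₃, hs₃b₂, hO1, ?_, hO3, hO4⟩
  -- (O2)
  intro x y hxy hs₃y hyb₂
  rcases le_total b₁ x with hbx | hbx
  · have h1 := hE x y hbx hxy hyb₂ hs₃y
    calc ‖u x‖ ≤ Real.exp (2 * ε * (s₃ - b₁)) * ‖u y‖ := h1
      _ ≤ Real.exp (1 / 2) * ‖u y‖ := mul_le_mul_of_nonneg_right hexpE (norm_nonneg _)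
      _ ≤ 12 * ‖u y‖ := mul_le_mul_of_nonneg_right (by linarith) (norm_nonneg _)
  · have h1 := hO4 x hbx
    have h2 := hO3 y ⟨hs₃y, hyb₂⟩
    linarith

end SliverNear

end Kerr

end Literature.Geometry.Lorentzian

end
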